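import Mathlib
import Literature.Computability.Complexity.RangeAvoidance
import Literature.Computability.Complexity.SignDegreeXor
import HarnessLib.Audit
import Summits.PneNP.PneNP.Theorems.PstarSAClosure
import Summits.PneNP.PneNP.Theorems.PstarExpandingModel
import Summits.PneNP.PneNP.Theorems.QuotientSABlocks

/-!
# ROUND-22 COR-B, target B3 (`BlockExpandExist`), part I: the random block model (cell `pnp-ideate`)

FRONTIER range-avoidance ladder, rung F-N3 context (restricted-model combinatorics; nothing here bears on `P` vs `NP`).

The model layer for the existence of boundary-expanding clean block systems (`QuotientSABlocks.BlockExpandExist`), in the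
shape of `IP3ExpandingModel` with `Fin 6` replaced by the slot type `Slot s` (arity `K = kBlk s = (s+1)s`):

* cardinalities `card_slot : kBlk s = (s+1)s`, `two_mul_card_edge : 2·#Edge s = (s+1)s`, `two_mul_card_tri : 2·#Tri s = s(s−1)`,
  and the STRETCH ARITHMETIC `stretch_arith`: with `n' = nb ≥ 1` and `s = 2C+3` the block system has `n < m`, `C·n ≤ m`,
  `m ≤ β + n`, `n' ≤ n` and `3 ≤ K` (the side conditions of `BlockExpandExist`);
* the model: an outcome `ω : Fin nb → (Slot s ↪ Fin n')` gives the clean block system `sysOf d ω` (`d` a junk value for the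
  diagonal); `blk_sysOf_vars`, `mem_nbhd_blk`;
* `boundaryExpandingQ_blk`: vertex expansion `|N(J)| ≥ (K − 5/4)|J|` (stated as `4K|J| ≤ 4|N(J)| + 5|J|`) for `|J| ≤ r`
  ⇒ `BoundaryExpandingQ (2K−5) 2 r (blk A b)` (degree counting, `PstarExpandingModel.two_card_nbhd_le`);
* `embIn A`, `card_embIn_le` (`≤ |A|^K`), `exists_set_of_small_nbhd` (containment behind the union bound).

Parts II/III (the union bound and the term estimate, = `IP3ExpandingCount`/`Exist` at arity `K`, threshold
`vK f = K f − ⌈5f/4⌉`) then give `BlockExpandExist`.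
-/

set_option linter.dupNamespace false

open Finset Literature.Computability.Complexity
open Summit.PneNP.PneNP.Theorems.PstarSALevel (varSet bdry)
open Summit.PneNP.PneNP.Theorems.PstarSASDPLevel (BoundaryExpandingQ)
open Summit.PneNP.PneNP.Theorems.PstarSAClosure (nbhd mem_nbhd)
open Summit.PneNP.PneNP.Theorems.PstarExpandingModel (two_card_nbhd_le)
open Summit.PneNP.PneNP.Theorems.QuotientSABlocks

namespace Summit.PneNP.PneNP.Theorems.QuotientSABlockModel

/-! ## Cardinalities of the index types and the stretch arithmetic -/

/-- `#{(v, w) : v ≠ w} = t² − t`. -/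
theorem card_ne_pairs (t : ℕ) : Fintype.card {p : Fin t × Fin t // p.1 ≠ p.2} = t * t - t := by
  rw [Fintype.card_subtype]
  have h : (Finset.univ.filter fun p : Fin t × Fin t => p.1 ≠ p.2) = (Finset.univ : Finset (Fin t)).offDiag := by
    ext p
    simp [Finset.mem_offDiag]
  rw [h, Finset.offDiag_card, Finset.card_univ, Fintype.card_fin]

/-- `2·#{(v, w) : v < w} = t² − t`. -/
theorem two_mul_card_lt_pairs (t : ℕ) : 2 * Fintype.card {p : Fin t × Fin t // p.1 < p.2} = t * t - t := by
  have e : {p : Fin t × Fin t // p.1 < p.2} ≃ {p : Fin t × Fin t // p.2 < p.1} :=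
    (Equiv.prodComm (Fin t) (Fin t)).subtypeEquiv fun _ => Iff.rfl
  rw [two_mul, ← card_ne_pairs]
  nth_rewrite 2 [Fintype.card_congr e]
  rw [Fintype.card_subtype, Fintype.card_subtype, Fintype.card_subtype, ← Finset.card_union_of_disjoint]
  · congr 1
    ext p
    simp only [Finset.mem_union, Finset.mem_filter, Finset.mem_univ, true_and]
    exact ne_iff_lt_or_gt.symm
  · exact Finset.disjoint_filter.2 fun p _ h1 h2 => lt_asymm h1 h2

/-- `K = #Slot s = (s+1)s`. -/
theorem card_slot (s : ℕ) : kBlk s = (s + 1) * s := by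
  unfold kBlk Slot
  rw [card_ne_pairs]
  have : (s + 1) * (s + 1) = (s + 1) * s + (s + 1) := by ring
  omega

/-- `2·#Edge s = (s+1)s`. -/
theorem two_mul_card_edge (s : ℕ) : 2 * Fintype.card (Edge s) = (s + 1) * s := by
  unfold Edge
  rw [two_mul_card_lt_pairs]
  have : (s + 1) * (s + 1) = (s + 1) * s + (s + 1) := by ring
  omega

/-- `2·#Tri s = s(s−1)`. -/
theorem two_mul_card_tri (s : ℕ) : 2 * Fintype.card (Tri s) = s * (s - 1) := by
  unfold Tri
  rw [two_mul_card_lt_pairs, Nat.mul_sub_one]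

/-- **Stretch arithmetic.**  With `n' = nb ≥ 1` A-variables and blocks `K_{s+1}`, `s = 2C+3`: `n < m`, `C·n ≤ m`,
`m ≤ β + n`, `n' ≤ n`, `3 ≤ K`. -/
theorem stretch_arith (C nb : ℕ) (hnb : 1 ≤ nb) :
    nVars (2 * C + 3) nb nb < mOut (2 * C + 3) nb ∧ C * nVars (2 * C + 3) nb nb ≤ mOut (2 * C + 3) nb ∧
      mOut (2 * C + 3) nb ≤ βOut (2 * C + 3) nb + nVars (2 * C + 3) nb nb ∧ nb ≤ nVars (2 * C + 3) nb nb ∧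
      3 ≤ kBlk (2 * C + 3) := by
  have hE := two_mul_card_edge (2 * C + 3)
  have hT := two_mul_card_tri (2 * C + 3)
  have hK := card_slot (2 * C + 3)
  have hE' : Fintype.card (Edge (2 * C + 3)) = (C + 2) * (2 * C + 3) := by nlinarith
  have hT' : Fintype.card (Tri (2 * C + 3)) = (2 * C + 3) * (C + 1) := by
    have : (2 * C + 3) * (2 * C + 3 - 1) = 2 * ((2 * C + 3) * (C + 1)) := by
      rw [show 2 * C + 3 - 1 = 2 * C + 2 by omega]; ring
    omega
  unfold nVars mOut βOut
  rw [hE', hT', hK]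
  have h1 : 2 * C + 5 < (C + 2) * (2 * C + 3) := by nlinarith
  have h1' := Nat.mul_lt_mul_of_pos_left h1 hnb
  refine ⟨by nlinarith, ?_, ?_, ?_, ?_⟩ <;> nlinarith

/-! ## The model -/

variable {s nb n' : ℕ}

/-- An outcome: for every block an injective slot map `Slot s ↪ Fin n'`. -/
abbrev Outcome (s nb n' : ℕ) : Type := Fin nb → (Slot s ↪ Fin n')

/-- **The block system of an outcome** (`d` is the junk value on the diagonal). -/
def sysOf (d : Fin n') (ω : Outcome s nb n') : BlockSys s nb n' where
  avar β v w := if h : v = w then d else ω β ⟨(v, w), h⟩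
  clean β := by
    intro p q hpq
    have hp : ¬p.1.1 = p.1.2 := p.2
    have hq : ¬q.1.1 = q.1.2 := q.2
    simp only [hp, hq, dite_false] at hpq
    exact (ω β).injective hpq

/-- Off the diagonal the A-variables are the slot map. -/
theorem sysOf_avar (d : Fin n') (ω : Outcome s nb n') (β : Fin nb) (p : Slot s) :
    (sysOf d ω).avar β p.1.1 p.1.2 = ω β p := by
  have hp : ¬p.1.1 = p.1.2 := p.2
  simp only [sysOf, hp, dite_false]

/-- The variables of the block map of an outcome. -/
theorem blk_sysOf_vars (d : Fin n') (ω : Outcome s nb n') (b : Fin (βOut s nb) → Bool) (β : Fin nb)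
    (k : Fin (kBlk s)) : (blk (sysOf d ω) b).vars β k = ω β ((eSlot s).symm k) := by
  show (sysOf d ω).avar β _ _ = _
  exact sysOf_avar d ω β _

/-- The block map reads injective slots (any block system). -/
theorem blk_vars_injective (A : BlockSys s nb n') (b : Fin (βOut s nb) → Bool) (β : Fin nb) :
    Function.Injective ((blk A b).vars β) := fun k k' h =>
  (eSlot s).symm.injective (A.clean β (a₁ := (eSlot s).symm k) (a₂ := (eSlot s).symm k') h)

/-- `N(J)` of the block map of an outcome: the union of the ranges of the slot maps. -/
theorem mem_nbhd_blk (d : Fin n') (ω : Outcome s nb n') (b : Fin (βOut s nb) → Bool) (J : Finset (Fin nb))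
    (v : Fin n') : v ∈ nbhd (blk (sysOf d ω) b) J ↔ ∃ β ∈ J, ∃ p : Slot s, ω β p = v := by
  simp only [PstarSAClosure.nbhd, PstarSALevel.varSet, Finset.mem_biUnion, Finset.mem_image, Finset.mem_univ,
    true_and, blk_sysOf_vars]
  constructor
  · rintro ⟨β, hβ, k, hk⟩
    exact ⟨β, hβ, (eSlot s).symm k, hk⟩
  · rintro ⟨β, hβ, p, hp⟩
    exact ⟨β, hβ, eSlot s p, by rwa [Equiv.symm_apply_apply]⟩

/-! ## Vertex expansion ⇒ boundary expansion at ratio `(2K−5)/2` -/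

/-- The arithmetic of degree counting. -/
theorem arith_bdry (K c N B : ℕ) (h1 : 4 * K * c ≤ 4 * N + 5 * c) (h2 : 2 * N ≤ B + K * c) :
    (2 * K - 5) * c ≤ 2 * B := by
  rw [Nat.sub_mul, Nat.mul_assoc]
  rw [Nat.mul_assoc] at h1
  omega

/-- **Vertex expansion ⇒ `(r, (2K−5)/2)`-boundary expansion** for the block map: if every `≤ r` blocks meet at least
`(K − 5/4)·|J|` A-variables then `BoundaryExpandingQ (2K−5) 2 r`. -/
theorem boundaryExpandingQ_blk (A : BlockSys s nb n') (b : Fin (βOut s nb) → Bool) (r : ℕ)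
    (h : ∀ J : Finset (Fin nb), J.card ≤ r → 4 * kBlk s * J.card ≤ 4 * (nbhd (blk A b) J).card + 5 * J.card) :
    BoundaryExpandingQ (2 * kBlk s - 5) 2 r (blk A b) := by
  intro J hJ
  exact arith_bdry _ _ _ _ (h J hJ) (two_card_nbhd_le (blk A b) (blk_vars_injective A b) J)

/-! ## Containment behind the union bound -/

/-- The slot maps whose range lies inside `A`. -/
noncomputable def embIn (A : Finset (Fin n')) : Finset (Slot s ↪ Fin n') := univ.filter fun e => ∀ p, e p ∈ A

/-- `|embIn A| ≤ |A|^K`. -/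
theorem card_embIn_le (A : Finset (Fin n')) : (embIn (s := s) A).card ≤ A.card ^ kBlk s := by
  classical
  have h : (embIn (s := s) A).card ≤ (Fintype.piFinset fun _ : Slot s => A).card := by
    refine Finset.card_le_card_of_injOn (fun e => (e : Slot s → Fin n')) ?_ ?_
    · intro e he
      simp only [embIn, Finset.coe_filter, Set.mem_setOf_eq, Finset.mem_univ, true_and] at he
      rw [Finset.mem_coe, Fintype.mem_piFinset]
      exact he
    · intro e _ e' _ h
      exact DFunLike.coe_injective h
  refine h.trans ?_
  rw [Fintype.card_piFinset, Finset.prod_const, Finset.card_univ]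

/-- **Containment.**  If `|N(J)| ≤ v ≤ n'` then some `A ⊆ Fin n'` with `|A| = v` contains the range of the slot map of every
block of `J`. -/
theorem exists_set_of_small_nbhd (d : Fin n') (ω : Outcome s nb n') (b : Fin (βOut s nb) → Bool) (J : Finset (Fin nb))
    (v : ℕ) (hvN : v ≤ n') (h : (nbhd (blk (sysOf d ω) b) J).card ≤ v) :
    ∃ A : Finset (Fin n'), A.card = v ∧ ∀ β ∈ J, ω β ∈ embIn A := by
  obtain ⟨A, hXA, -, hA⟩ :=
    Finset.exists_subsuperset_card_eq (Finset.subset_univ (nbhd (blk (sysOf d ω) b) J)) h (by simp; omega)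
  refine ⟨A, hA, fun β hβ => ?_⟩
  simp only [embIn, Finset.mem_filter, Finset.mem_univ, true_and]
  intro p
  exact hXA ((mem_nbhd_blk d ω b J _).2 ⟨β, hβ, p, rfl⟩)

/-- **Model summary for part III.**  A vertex-expanding outcome at radius `r` yields the block system required by
`BlockExpandExist` at that radius (all targets `b` at once, since expansion depends on the slots only). -/
theorem blockSys_of_good (d : Fin n') (ω : Outcome s nb n') (r : ℕ)
    (h : ∀ (b : Fin (βOut s nb) → Bool) (J : Finset (Fin nb)), J.card ≤ r →
      4 * kBlk s * J.card ≤ 4 * (nbhd (blk (sysOf d ω) b) J).card + 5 * J.card) :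
    ∀ b : Fin (βOut s nb) → Bool, BoundaryExpandingQ (2 * kBlk s - 5) 2 r (blk (sysOf d ω) b) :=
  fun b => boundaryExpandingQ_blk (sysOf d ω) b r (h b)

end Summit.PneNP.PneNP.Theorems.QuotientSABlockModel
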